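import Summits.NavierStokesRegularity.NavierStokesRegularity.Theorems.ExtremiserTransienceNearExtremalTransienceUniaxialityDefect
import Summits.NavierStokesRegularity.NavierStokesRegularity.Theorems.TypeICertificateLadderTargetStrainCubeSharpDepletion
import Summits.NavierStokesRegularity.NavierStokesRegularity.Theorems.TypeICertificateLadderTargetFlowwiseDepletionEventualRung
import HarnessLib

/-!
# Crux `Target` (stmt-NavierStokesRegularity-1217) / line `ExtremiserTransience` (crux 21883): THE UNIAXIAL DOOR —
# Type-I blow-up above the constant-form reach forces the strain to become UNIAXIAL in `|S|³`-measure,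
# frequently as `t ↑ T`

`--supports stmt-NavierStokesRegularity-1217` (helper; an EVENTUAL DOOR in the sense of `rung_of_eventualDepletion`,
the first one fed by the structure of near-extremisers — companion of
`…NearExtremalTransienceUniaxialityDefect` / `…MillerStability`).

With the uniaxiality defect `𝔡(S) = (|S|⁶/54 − det(S)²)/|S|³ ≥ 0` (`= |S|³ sin²(3φ)/54`, `φ` the Lund–Rogers
strain-state angle) the integrated first link of the depletion chain reads
`|∫⟪ω, Dv ω⟫| + 6√6∫𝔡(S) ≤ (2√6/9)∫|S|³` (`abs_integral_stretching_add_defect_le_integral_cube`). Feeding it into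
the sharp interpolation `∫|S|³ ≤ M(½‖Δv‖₂‖S‖₂ + √(2/3)‖S‖₂‖∇S‖₂)` (`integral_strainCube_le_sharp`) gives a
FLOW-WISE depletion coefficient from a geometric statistic of the strain:

* `abs_integral_stretching_le_of_nonUniaxial` — kinematic: if `6√6∫𝔡(S) ≥ ε·(2√6/9)∫|S|³` (the strain is
  `ε`-NON-uniaxial in `|S|³`-measure) then `|∫⟪ω, Dv ω⟫| ≤ (1 − ε)·((2+√3)/9)·M·‖ω‖₂·‖∇ω‖₂`.
* `hasSmoothExtensionPast_of_eventually_nonUniaxial` — **THE UNIAXIAL DOOR**: a classical Leray–Hopf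
  rapidly-decaying-datum solution on `[0,T)` with eventual rate `√(T−t)‖u‖ ≤ C√ν` whose strain stays
  `ε`-non-uniaxial on some `[t₁, T)`, with `(1 − ε)·((2+√3)/9)·C < 1`, extends smoothly past `T`
  (`rung_of_eventualDepletion` with `κ = (1−ε)(2+√3)/9`). Reach: `C < (18 − 9√3)/(1 − ε)`.
* `frequently_uniaxial_of_blowup` — contrapositive, the NECESSARY CONDITION: at a singular time approached at
  dimensionless rate `C`, for every `ε ≤ 1` with `(1−ε)((2+√3)/9)C < 1` the strain is `ε`-uniaxial
  FREQUENTLY as `t ↑ T`: `∃ᶠ t → T⁻, 6√6∫𝔡(S(t)) < ε·(2√6/9)∫|S(t)|³` — e.g. a Type-I blow-up at rate `C = 4.82`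
  must have `|S|³`-weighted `⟨sin²3φ⟩ < 1` … at rate `C = 2.41/(1−ε)` it needs `⟨54𝔡/|S|³⟩_{|S|³} < 2ε`
  arbitrarily close to `T`.

Numbers: at `C = 3` the door needs `ε > 1 − 2.4115/3 = 0.196`; at `C = 10`, `ε > 0.759`; as `C → ∞` the strain of a
Type-I singular flow must be asymptotically uniaxial along a sequence of times (`ε → 1`). DNS context (MODEL, not
used): Lund–Rogers 1994 / Ashurst et al. 1987 report `s*` peaked near `+1` in the high-strain regions of isotropic
turbulence — the door is NOT generically shut, which is what makes it a door and not a proof.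

WHAT THIS IS NOT: a conditional criterion (door); no statement that Type-I blow-up is impossible; nothing on
Type II. References: Lund–Rogers, Phys. Fluids 6 (1994) 1838; E. Miller, ARMA 235 (2020) Prop. 4.8; Leray 1934
§§19–20. [folklore]
-/

noncomputable section

open Set Function Filter Topology MeasureTheory Finset
open scoped RealInnerProductSpace ENNReal NNReal Laplacian ContDiff
open Literature.Analysis.FluidPDE

namespace Summit.NavierStokesRegularity.NavierStokesRegularity.Theorems.DepletionLadder.StrainCube

-- the problem directory repeats the summit name (`NavierStokesRegularity/NavierStokesRegularity`)
set_option linter.dupNamespace false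

open Summit.NavierStokesRegularity.NavierStokesRegularity.Theorems.RungReynoldsOne
open Summit.NavierStokesRegularity.NavierStokesRegularity.Theorems.RungReynoldsOne.WeightedSlice
open Summit.NavierStokesRegularity.NavierStokesRegularity.Theorems.DepletionLadder

variable {v : EuclideanSpace ℝ (Fin 3) → EuclideanSpace ℝ (Fin 3)}

/-- **Non-uniaxial strain depletes the stretching (kinematic).** For a `C^∞` divergence-free `v : ℝ³ → ℝ³` with
`|v| ≤ M`, `‖Dv‖ ≤ B`, `D⁰v, D¹v, D²v ∈ L²`, strain entries `sᵢⱼ`, and `ε ≤ 1`: if the uniaxiality defect is at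
least an `ε`-fraction of the strain cube, `ε·(2√6/9)∫|S|³ ≤ 6√6∫𝔡(S)`, then
`|∫⟪ω, Dv ω⟫| ≤ (1 − ε)·((2+√3)/9)·M·√(∫‖ω‖²)·√(∫|∇ω|²_F)`. [folklore] -/
theorem abs_integral_stretching_le_of_nonUniaxial (hv : ContDiff ℝ ∞ v) (hdiv : VectorCalculus.IsDivFree v)
    {M B ε : ℝ} (hM : ∀ x, ‖v x‖ ≤ M) (hB : ∀ x, ‖fderiv ℝ v x‖ ≤ B)
    (h0 : ∫⁻ x, ‖iteratedFDeriv ℝ 0 v x‖ₑ ^ 2 < ⊤) (h1 : ∫⁻ x, ‖iteratedFDeriv ℝ 1 v x‖ₑ ^ 2 < ⊤)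
    (h2 : ∫⁻ x, ‖iteratedFDeriv ℝ 2 v x‖ₑ ^ 2 < ⊤)
    {s : Fin 3 → Fin 3 → EuclideanSpace ℝ (Fin 3) → ℝ}
    (hs : ∀ i j y, s i j y = (pderiv j (fun z => v z i) y + pderiv i (fun z => v z j) y) / 2)
    (hε1 : ε ≤ 1)
    (hε : ε * ((2 / 9) * Real.sqrt 6 * ∫ x, (∑ i, ∑ j, s i j x ^ 2) * Real.sqrt (∑ i, ∑ j, s i j x ^ 2)) ≤
      6 * Real.sqrt 6 * ∫ x, ((∑ i, ∑ j, s i j x ^ 2) ^ 3 / 54 - (Matrix.of fun i j => s i j x).det ^ 2) /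
        ((∑ i, ∑ j, s i j x ^ 2) * Real.sqrt (∑ i, ∑ j, s i j x ^ 2))) :
    |∫ x, ⟪curl v x, fderiv ℝ v x (curl v x)⟫| ≤
      (1 - ε) * ((2 + Real.sqrt 3) / 9) * M * Real.sqrt (∫ x, ‖curl v x‖ ^ 2) *
        Real.sqrt (∫ x, frobeniusNormSq (fderiv ℝ (curl v) x)) := by
  have hM0 : 0 ≤ M := (norm_nonneg _).trans (hM 0)
  set Z := ∫ x, ‖curl v x‖ ^ 2 with hZ
  set W := ∫ x, frobeniusNormSq (fderiv ℝ (curl v) x) with hW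
  set I3 := ∫ x, (∑ i, ∑ j, s i j x ^ 2) * Real.sqrt (∑ i, ∑ j, s i j x ^ 2) with hI3
  have hD := abs_integral_stretching_add_defect_le_integral_cube hv hdiv hM hB h1 hs
  have hI := integral_strainCube_le_sharp hv hdiv hM hB h1 h2 hs
  have e1 : ∫ x, ∑ i, ∑ j, s i j x ^ 2 = (1 / 2) * Z := integral_sumSq_sym_eq_half hv hdiv h0 h1 hs
  have e2 : ∫ x, ∑ l, ∑ i, ∑ j, pderiv l (s i j) x ^ 2 = (1 / 2) * W :=
    integral_gradSq_sym_eq_half hv hdiv h1 h2 hs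
  have e3 : ∫ x, ‖(Δ v) x‖ ^ 2 = W := integral_norm_laplacian_sq_eq hv hdiv h1 h2
  rw [e1, e2, e3] at hI
  -- `|∫J| ≤ (1 − ε) c I₃`
  have hJ : |∫ x, ⟪curl v x, fderiv ℝ v x (curl v x)⟫| ≤ (1 - ε) * ((2 / 9) * Real.sqrt 6 * I3) := by
    have := hD
    rw [← hI3] at this
    linarith
  -- the interpolation, with the sharp constant bookkeeping
  have hI3le : (2 / 9) * Real.sqrt 6 * I3 ≤ (2 + Real.sqrt 3) / 9 * M * Real.sqrt Z * Real.sqrt W := by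
    have hc : 0 ≤ (2 / 9) * Real.sqrt 6 := by positivity
    calc (2 / 9) * Real.sqrt 6 * I3
        ≤ (2 / 9) * Real.sqrt 6 * (M * ((1 / 2) * Real.sqrt W * Real.sqrt ((1 / 2) * Z) +
            Real.sqrt (2 / 3) * Real.sqrt ((1 / 2) * Z) * Real.sqrt ((1 / 2) * W))) :=
          mul_le_mul_of_nonneg_left hI hc
      _ = (2 + Real.sqrt 3) / 9 * M * Real.sqrt Z * Real.sqrt W := by
          rw [show (2 / 9) * Real.sqrt 6 * (M * ((1 / 2) * Real.sqrt W * Real.sqrt ((1 / 2) * Z) +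
              Real.sqrt (2 / 3) * Real.sqrt ((1 / 2) * Z) * Real.sqrt ((1 / 2) * W))) =
              M * ((2 / 9) * Real.sqrt 6 * ((1 / 2) * Real.sqrt W * Real.sqrt ((1 / 2) * Z) +
              Real.sqrt (2 / 3) * Real.sqrt ((1 / 2) * Z) * Real.sqrt ((1 / 2) * W))) by ring,
            depletion_constant_sharp_eq Z W]
          ring
  have h1ε : 0 ≤ 1 - ε := sub_nonneg.2 hε1
  calc |∫ x, ⟪curl v x, fderiv ℝ v x (curl v x)⟫| ≤ (1 - ε) * ((2 / 9) * Real.sqrt 6 * I3) := hJ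
    _ ≤ (1 - ε) * ((2 + Real.sqrt 3) / 9 * M * Real.sqrt Z * Real.sqrt W) :=
        mul_le_mul_of_nonneg_left hI3le h1ε
    _ = (1 - ε) * ((2 + Real.sqrt 3) / 9) * M * Real.sqrt Z * Real.sqrt W := by ring

/-- **THE UNIAXIAL DOOR.** Let `u` be a classical solution of the unforced Navier–Stokes system on `ℝ³ × [0,T)`
(`ν, T > 0`), Leray–Hopf from its rapidly decaying datum, with eventual dimensionless rate `√(T−t)‖u(t,x)‖ ≤ C√ν`,
`C > 0`. Suppose that for some `ε ≤ 1` with `(1−ε)·((2+√3)/9)·C < 1` and some `t₁ ∈ [0,T)` the strain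
`S(t)` of `u(t)` is `ε`-NON-uniaxial in `|S|³`-measure at every `t ∈ [t₁, T)`:
`ε·(2√6/9)∫|S(t)|³ ≤ 6√6∫𝔡(S(t))`. Then `u` extends smoothly past `T`. [folklore] -/
theorem hasSmoothExtensionPast_of_eventually_nonUniaxial {ν T C ε t₁ : ℝ} (hν : 0 < ν) (hT : 0 < T)
    (hC : 0 < C) (hε1 : ε ≤ 1) (hεC : (1 - ε) * ((2 + Real.sqrt 3) / 9) * C < 1)
    (ht₁ : t₁ ∈ Ico 0 T)
    {u : ℝ → EuclideanSpace ℝ (Fin 3) → EuclideanSpace ℝ (Fin 3)}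
    {p : ℝ → EuclideanSpace ℝ (Fin 3) → ℝ}
    (hsol : IsClassicalNSSolutionOn (Ico 0 T) ν 0 u p) (hLH : IsLerayHopfOn T ν 0 (u 0) u)
    (hdec : HasRapidSpatialDecay (u 0))
    (hnon : ∀ t ∈ Ico t₁ T, ∀ s : Fin 3 → Fin 3 → EuclideanSpace ℝ (Fin 3) → ℝ,
      (∀ i j y, s i j y = (pderiv j (fun z => u t z i) y + pderiv i (fun z => u t z j) y) / 2) →
      ε * ((2 / 9) * Real.sqrt 6 * ∫ x, (∑ i, ∑ j, s i j x ^ 2) * Real.sqrt (∑ i, ∑ j, s i j x ^ 2)) ≤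
        6 * Real.sqrt 6 * ∫ x, ((∑ i, ∑ j, s i j x ^ 2) ^ 3 / 54 - (Matrix.of fun i j => s i j x).det ^ 2) /
          ((∑ i, ∑ j, s i j x ^ 2) * Real.sqrt (∑ i, ∑ j, s i j x ^ 2)))
    (hrate : ∀ᶠ t in 𝓝[<] T, ∀ x, Real.sqrt (T - t) * ‖u t x‖ ≤ C * Real.sqrt ν) :
    HasSmoothExtensionPast ν 0 u T := by
  have hκ0 : 0 ≤ (1 - ε) * ((2 + Real.sqrt 3) / 9) := by
    have : 0 ≤ 1 - ε := sub_nonneg.2 hε1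
    positivity
  refine rung_of_eventualDepletion hν hT hκ0 hC hεC ht₁ hsol hLH hdec (fun t ht M hM => ?_) hrate
  have htT : t ∈ Ico 0 T := ⟨ht₁.1.trans ht.1, ht.2⟩
  have ht' : (t + T) / 2 ∈ Ioo 0 T := ⟨by linarith [htT.1], by linarith [htT.2]⟩
  obtain ⟨q, hsolt, hut, -, -⟩ := stub_taoCover hν hT hsol hLH hdec ht'
  have htI : t ∈ Icc 0 ((t + T) / 2) := ⟨htT.1, by linarith [htT.2]⟩
  obtain ⟨C₀, hC₀⟩ := hut 0
  obtain ⟨C₁, hC₁⟩ := hut 1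
  obtain ⟨C₂, hC₂⟩ := hut 2
  obtain ⟨B₁, -, hB₁⟩ := exists_forall_norm_fderiv_le_of_hasBoundedSobolevNormsOn
    (fun r hr => (hsolt.contDiff_velocity hr).of_le (by norm_cast)) hut
  have h0 : ∫⁻ x, ‖iteratedFDeriv ℝ 0 (u t) x‖ₑ ^ 2 < ⊤ := (hC₀ t htI).trans_lt ENNReal.coe_lt_top
  have h1 : ∫⁻ x, ‖iteratedFDeriv ℝ 1 (u t) x‖ₑ ^ 2 < ⊤ := (hC₁ t htI).trans_lt ENNReal.coe_lt_top
  have h2 : ∫⁻ x, ‖iteratedFDeriv ℝ 2 (u t) x‖ₑ ^ 2 < ⊤ := (hC₂ t htI).trans_lt ENNReal.coe_lt_top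
  have hv : ContDiff ℝ ∞ (u t) := hsol.contDiff_velocity htT
  have hdiv : VectorCalculus.IsDivFree (u t) := hsol.divFree t htT
  set s : Fin 3 → Fin 3 → EuclideanSpace ℝ (Fin 3) → ℝ :=
    fun i j y => (pderiv j (fun z => u t z i) y + pderiv i (fun z => u t z j) y) / 2 with hsdef
  have hs : ∀ i j y, s i j y = (pderiv j (fun z => u t z i) y + pderiv i (fun z => u t z j) y) / 2 :=
    fun i j y => rfl
  exact abs_integral_stretching_le_of_nonUniaxial hv hdiv hM (hB₁ t htI) h0 h1 h2 hs hε1 (hnon t ht s hs)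

/-- **NECESSARY CONDITION FOR TYPE-I BLOW-UP: the strain becomes uniaxial, frequently.** If the classical
Leray–Hopf rapidly-decaying-datum solution `u` on `[0,T)` with eventual dimensionless rate `C > 0` does NOT extend
smoothly past `T`, then for every `ε ≤ 1` with `(1−ε)((2+√3)/9)C < 1` the strain is `ε`-uniaxial in
`|S|³`-measure at times arbitrarily close to `T`:
`∃ᶠ t → T⁻, 6√6∫𝔡(S(t)) < ε·(2√6/9)∫|S(t)|³`. As `C → ∞` (`ε → 1`) the strain of a Type-I singular flow is
asymptotically uniaxial (`s* → ±1` in `|S|³`-measure) along a sequence of times. [folklore] -/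
theorem frequently_uniaxial_of_blowup {ν T C ε : ℝ} (hν : 0 < ν) (hT : 0 < T) (hC : 0 < C)
    (hε1 : ε ≤ 1) (hεC : (1 - ε) * ((2 + Real.sqrt 3) / 9) * C < 1)
    {u : ℝ → EuclideanSpace ℝ (Fin 3) → EuclideanSpace ℝ (Fin 3)}
    {p : ℝ → EuclideanSpace ℝ (Fin 3) → ℝ}
    (hsol : IsClassicalNSSolutionOn (Ico 0 T) ν 0 u p) (hLH : IsLerayHopfOn T ν 0 (u 0) u)
    (hdec : HasRapidSpatialDecay (u 0))
    (hrate : ∀ᶠ t in 𝓝[<] T, ∀ x, Real.sqrt (T - t) * ‖u t x‖ ≤ C * Real.sqrt ν)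
    (hsing : ¬ HasSmoothExtensionPast ν 0 u T) :
    ∃ᶠ t in 𝓝[<] T, ∃ s : Fin 3 → Fin 3 → EuclideanSpace ℝ (Fin 3) → ℝ,
      (∀ i j y, s i j y = (pderiv j (fun z => u t z i) y + pderiv i (fun z => u t z j) y) / 2) ∧
      6 * Real.sqrt 6 * ∫ x, ((∑ i, ∑ j, s i j x ^ 2) ^ 3 / 54 - (Matrix.of fun i j => s i j x).det ^ 2) /
          ((∑ i, ∑ j, s i j x ^ 2) * Real.sqrt (∑ i, ∑ j, s i j x ^ 2)) <
        ε * ((2 / 9) * Real.sqrt 6 * ∫ x, (∑ i, ∑ j, s i j x ^ 2) * Real.sqrt (∑ i, ∑ j, s i j x ^ 2)) := by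
  by_contra h
  rw [not_frequently] at h
  obtain ⟨a, haT, hsub⟩ := mem_nhdsLT_iff_exists_Ioo_subset.1 h
  set t₁ : ℝ := (max a 0 + T) / 2 with ht₁def
  have hm : max a 0 < T := max_lt haT hT
  have ht₁ : t₁ ∈ Ico 0 T := by
    have := le_max_right a 0; rw [ht₁def]; constructor <;> linarith
  have hat₁ : a < t₁ := by
    have := le_max_left a 0; rw [ht₁def]; linarith
  have hnon : ∀ t ∈ Ico t₁ T, ∀ s : Fin 3 → Fin 3 → EuclideanSpace ℝ (Fin 3) → ℝ,
      (∀ i j y, s i j y = (pderiv j (fun z => u t z i) y + pderiv i (fun z => u t z j) y) / 2) →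
      ε * ((2 / 9) * Real.sqrt 6 * ∫ x, (∑ i, ∑ j, s i j x ^ 2) * Real.sqrt (∑ i, ∑ j, s i j x ^ 2)) ≤
        6 * Real.sqrt 6 * ∫ x, ((∑ i, ∑ j, s i j x ^ 2) ^ 3 / 54 - (Matrix.of fun i j => s i j x).det ^ 2) /
          ((∑ i, ∑ j, s i j x ^ 2) * Real.sqrt (∑ i, ∑ j, s i j x ^ 2)) := by
    intro t ht s hs
    have hno := hsub ⟨hat₁.trans_le ht.1, ht.2⟩
    simp only [mem_setOf_eq, not_exists, not_and, not_lt] at hno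
    exact hno s hs
  exact hsing (hasSmoothExtensionPast_of_eventually_nonUniaxial hν hT hC hε1 hεC ht₁ hsol hLH hdec
    hnon hrate)

end Summit.NavierStokesRegularity.NavierStokesRegularity.Theorems.DepletionLadder.StrainCube

end
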